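/-
Copyright (c) 2026 the pub-hodgecm-mathlib formalisation cell (harness21).  Prover seat hodgecm-mathlib-LH4-p17 (g0), req620 Track A «(D-RAM) FOUR-FRAME» squad, helper lane on
h413 = stmt-HodgeConjecture-24833 (count-neutral).  β-BOARD v1 (sub-dealer LH4-p05 (g8)) row R3 «G₁ ε-BOUNDARY TOWER FILE» — THE HEAD: the `hP3G1` letter of (T2) `hbox_of_oddBoxSum`
∕ (T1) ★ p861261 `hG1b`, VERBATIM.  2026-09-04.
-/
import Summits.HodgeConjecture.HodgeConjecture.Theorems.F0P3cDyRamLabelledOddBoundaryG1Slots       -- ★ (this seat): slots 0 and 1; brings ★ `…BoundaryG1Orbits` (orbit kit), ★ p861608 (sums)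
import Summits.HodgeConjecture.HodgeConjecture.Theorems.F0P3cDyRamLabelledOddGluedCharacterTwo    -- ★ p861641 (this seat, FILE 3b): the slot-2 indicator
import Summits.HodgeConjecture.HodgeConjecture.Theorems.F0P3cDyRamDiagonalGluedTorusOrbits           -- ★: `exists_gl_coe_eq_glued`
import Summits.HodgeConjecture.HodgeConjecture.Theorems.F0P3cDyRamDiagonalGluedClassRepresentatives  -- ★: `exists_fixed_class_representatives`
import Summits.HodgeConjecture.HodgeConjecture.Theorems.F0P3cDyRamElementDatumParity               -- ★: `depth_mod_two_eq_of_isElementDatum`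
import HarnessLib

/-!
# Crux `H413`, line LH4 «(D-RAM) FOUR-FRAME» — (β) Stage B, β-BOARD R3: THE `G₁ = (2ρ, 2ρ+s, 2ρ+s)` CAPPED TUBE CLASSES BEYOND THE ONE-SLOT CELL
# `Σᶠ_{M ∈ stratum G₁, shell} m^Λ_i(M) ∕ [𝒰 : N(S̃′(M))] = ω(e_B)∕2 · q^{2ρ+s∕2−1} · (0, F(n₂), ω(−1)·F(n₃))_i`,  `F(n) = (q−1)·[2d+ℓ₀+2ρ ≤ n] − [n+2 = 2d+ℓ₀+2ρ]`

Cell `hodgecm-mathlib` (D-0151), FLOOR 0, crux item H413 = `stmt-HodgeConjecture-24833`, route `HCCMUnconditional`; squad F0∕P3c∕LH4.  THEOREMS ONLY (no `def`, no instance, no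
notation, no `sorry`, default heartbeats); ★-only imports; lane `--supports stmt-HodgeConjecture-24833 --as helper` (count-neutral); pays NO row, states NO law.  The statement is the
`hP3G1` hypothesis of F0P3a-p01 (g37)'s (T2) trunk `hbox_of_oddBoxSum` ∕ the `hG1b` row of ★ (T1) p861261 `OddLabelledBoxSum`, binder for binder (SIG v1 91f4458d «=» LH4-p05 (g8), REF5 R5-332).

THE PROOF.  Under the read `2ρ+s+ℓ₀ = n₁` and the cap `2ρ+2+ℓ₀ ≤ min n₂ n₃` every member of the stratum is on the clean shell (★ `…BoundaryG1Orbits` §1, the ★ G1 token reads off the glue foot); the stratum is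
the glued family (★ `stratum_G1_eq`), whose labelled table decomposes over the representatives `latt V(1,1,g)` (★ LH7-p05), all `T`-stable on the tube; on each, ★ FILE 5a p861666 gives
`ω(e_B)·ω(1+rg)·(ω(g), 1, ω(−1)ω(1+g))_i∕2 · 𝟙_i · w` with `r = g_α∕g_β` (`g_β = e_B·π₀^{ρ+s∕2}`, `g_α` from ★ p13 `exists_fixed_mul_refSkew_near_sub_one`; `|rg| = |ϖ|^{n₂−ℓ₀−2ρ}` exactly
since `n₂ < 2ρ + m*`), the indicators being `[2d ≤ ρ+1]`, `[2d ≤ ρ+(n₂−ℓ₀−2ρ)+1]`, `[2d ≤ ρ+(n₃−ℓ₀−2ρ)+1]` (★ p861560 §4, ★ p861641); the sums over `g` are ★ p861608 (`0`;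
`−#R∕(q−1)·[n₂+2 = 2d+ℓ₀+2ρ]`; `#R·F(n₃)∕(q−1)` via `(1+g)(1+rg) = (1+g)²(1 + (r−1)g∕(1+g))`, `|(r−1)g| = |ϖ|^{n₃−ℓ₀−2ρ}` or deep); `|orbit|·w·#R = (q−1)q^{2ρ+s∕2−1}` (★ `orbit_mass_eq_pow`).
HONEST LABEL.  Count-neutral helper that FEEDS the `hP3G1` letter; the (β) pay line still needs `hP3G2`, `hP2G3`'s beyond half, `hRest` and (T3); `HC_CM` is proved only modulo the 7 printed
citations (2 remaining named inputs: hLiu418 = `stmt-HodgeConjecture-24832`, h413 = `stmt-HodgeConjecture-24833`) until rung 0 closes.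
References: [Kottwitz1986BaseChangeUnits] §1 pp. 240–241 · [Rogawski1990] §4.9 Prop. 4.9.1 (a)(b) p. 55, §4.10 p. 58 · [LanglandsShelstad1987] §3 · [Serre1979] Ch. V §3, Ch. XV §2.
-/

set_option autoImplicit false

noncomputable section

namespace Summit.HodgeConjecture.HodgeConjecture.Cruxes.H413.F0P3cDyRamLabelledOddBoundaryG1

open Matrix WithZero
open Literature.NumberTheory.Automorphic Literature.NumberTheory.Automorphic.HermitianLattice Literature.NumberTheory.Automorphic.UnitaryGroup
open Literature.NumberTheory.Automorphic.UnitaryLatticeTree Literature.NumberTheory.Automorphic.UnitaryThreeFourFrame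
open Literature.NumberTheory.LocalFields Literature.NumberTheory.LocalFields.WildQuadraticDatum
open Summit.HodgeConjecture.HodgeConjecture.Cruxes.H413.F0P3cDyRamFourFramePieces
open Summit.HodgeConjecture.HodgeConjecture.Cruxes.H413.F0P3cDyRamFourFrameCensusDefs
open Summit.HodgeConjecture.HodgeConjecture.Cruxes.H413.F0P3cDyRamStageOneBDefs (mcOfRecord)
open Summit.HodgeConjecture.HodgeConjecture.Cruxes.H413.F0P3cDyRamStageOneBDerivedDefs (n0DerivedOfRecord mcOfRecord_le_n0DerivedOfRecord)
open Summit.HodgeConjecture.HodgeConjecture.Cruxes.H413.F0P3cDyRamDiagonalTorusDefs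
open Summit.HodgeConjecture.HodgeConjecture.Cruxes.H413.F0P3cDyRamDiagonalStrataDefs
open Summit.HodgeConjecture.HodgeConjecture.Cruxes.H413.F0P3cDyRamDiagonalKappaCountDefs
open Summit.HodgeConjecture.HodgeConjecture.Cruxes.H413.F0P3cDyRamLabelledOddCountDefs
open Summit.HodgeConjecture.HodgeConjecture.Cruxes.H413.F0P3cDyRamDiagonalGluedStabiliserIndex (stabiliserWeight_latt_glued_tube_eq ne_zero_and_v_lt_one_of_v_eq_exp)
open Summit.HodgeConjecture.HodgeConjecture.Cruxes.H413.F0P3cDyRamDiagonalGluedTorusOrbits (exists_gl_coe_eq_glued)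
open Summit.HodgeConjecture.HodgeConjecture.Cruxes.H413.F0P3cDyRamDiagonalGluedClassRepresentatives (exists_fixed_class_representatives)
open Summit.HodgeConjecture.HodgeConjecture.Cruxes.H413.F0P3cDyRamDiagonalKappaGluedDecomposition (orbit_mass_eq_pow)
open Summit.HodgeConjecture.HodgeConjecture.Cruxes.H413.F0P3cDyRamElementDatumParity (depth_mod_two_eq_of_isElementDatum isoceles_of_isElementDatum)
open Summit.HodgeConjecture.HodgeConjecture.Cruxes.H413.F0P3cDyRamDiagonalKappaCoreHangingClass (two_le_d_of_v_two_lt_one)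
open Summit.HodgeConjecture.HodgeConjecture.Cruxes.H413.F0P3cDyRamLabelledOddGluedCharacterTwo (forall_normSign_two_mul_gluedChar_of_le exists_normSign_two_mul_gluedChar_ne_one)
open Summit.HodgeConjecture.HodgeConjecture.Cruxes.H413.F0P3cDyRamLabelledOddBoundarySums
open Summit.HodgeConjecture.HodgeConjecture.Cruxes.H413.F0P3cDyRamLabelledOddBoundaryG1Orbits (finsum_beyond_eq_card_mul_sum exists_ratio_beyond value_latt_glued_rep_eq normSign_unit_mul_normPow_mul)
open Summit.HodgeConjecture.HodgeConjecture.Cruxes.H413.F0P3cDyRamLabelledOddBoundaryG1Slots (card_mul_sum_value_zero_eq card_mul_sum_value_one_eq)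
open scoped Valued WithZero Matrix MatrixGroups

variable {K : Type} [Field K] [Valued K ℤᵐ⁰] [CompleteSpace K] [Fintype 𝓀[K]] {σ : K →+* K} {ϖ : K} {d t : ℕ} {α β : K} {n₁ n₂ n₃ : ℕ}

/-! ## §1  Slot `2` (third slot): the two regimes of `|r − 1|` -/

/-- **SLOT 2, CASE A** (`n₃ < m* + 2ρ`, exact twist depth `2j₂ = n₃ − ℓ₀ − 2ρ ≤ 2d−2`): indicator `[2d ≤ ρ+2j₂+1]` (★ p861641), `ω(−1)ω(1+g)·ω(1+rg) = ω(−1)·ω(1 + (r−1)g∕(1+g))`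
(★ p861608 `normSign_one_add_mul_one_add_eq`), and the Möbius sums of ★ p861608 (boundary `j₂ + 1 = d` ∕ zero). [cite: Rogawski1990, §4.9 Prop. 4.9.1 (b) p. 55] [cite: Serre1979, Ch. XV §2] -/
theorem card_mul_sum_value_two_eq_of_lt (h2 : Valued.v (2 : K) < 1) (hD : IsRamifiedQuadraticDatum σ ϖ d t)
    (hE : IsElementDatum σ ϖ (n0DerivedOfRecord d) α β n₁ n₂ n₃)
    (T : GL (Fin 3) K) (hT : (T : Matrix (Fin 3) (Fin 3) K) = Matrix.diagonal ![α, β, 1]) (ρ t' : ℕ) (hρ : 1 ≤ ρ) (ht' : 1 ≤ t')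
    (hbey : n₂ < 2 * ρ + (d % 2 + 2 * d - 1)) (hread : 2 * ρ + 2 * t' + d % 2 = n₁) (hcap : 2 * ρ + 2 + d % 2 ≤ min n₂ n₃)
    {eB : K} (hσeB : σ eB = eB) (heB1 : Valued.v eB = 1)
    (R : Finset K) (hR1' : ∀ g ∈ R, σ g = g ∧ Valued.v g = Valued.v ϖ ^ (2 * t'))
    (hR2' : ∀ f : K, σ f = f → Valued.v f = Valued.v ϖ ^ (2 * t') → ∃ g ∈ R, Valued.v (f - g) ≤ Valued.v ϖ ^ (ρ + 2 * t'))
    (hR3' : ∀ g ∈ R, ∀ g' ∈ R, Valued.v (g - g') ≤ Valued.v ϖ ^ (ρ + 2 * t') → g = g')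
    (hRcard : R.card = (Nat.card 𝓀[K] - 1) * Nat.card 𝓀[K] ^ ((ρ + 1) / 2 - 1))
    (V₀ : K → GL (Fin 3) K) (hV₀ : ∀ g, (V₀ g : Matrix (Fin 3) (Fin 3) K) = !![1, 0, 0; 1, ϖ ^ ρ, 0; 1 * 1 + g, ϖ ^ ρ * 1, ϖ ^ (2 * ρ + 2 * t')])
    {r : K} (hσr : σ r = r) (j₁ : ℕ) (hj₁ : n₂ = 2 * ρ + 2 * j₁ + d % 2)
    (hprecα : ∀ g ∈ R, Valued.v ((ϖ ^ (d % 2 + 2 * d - 1))⁻¹ * (((ϖ * σ ϖ) ^ (ρ + t'))⁻¹ * g *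
      ((α - 1) - r * (eB * (ϖ * σ ϖ) ^ (ρ + t')) * ((ϖ - σ ϖ) * ((ϖ * σ ϖ) ^ ((d - d % 2) / 2))⁻¹)))) ≤ 1)
    (hprecβ : Valued.v ((ϖ ^ (d % 2 + 2 * d - 1))⁻¹ * (((ϖ * σ ϖ) ^ (ρ + t'))⁻¹ *
      ((β - 1) - (eB * (ϖ * σ ϖ) ^ (ρ + t')) * ((ϖ - σ ϖ) * ((ϖ * σ ϖ) ^ ((d - d % 2) / 2))⁻¹)))) ≤ 1)
    (hvrg : ∀ g ∈ R, Valued.v (r * g) = Valued.v ϖ ^ (2 * j₁))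
    (hA : n₃ < d % 2 + 2 * d - 1 + 2 * ρ) (j₂ : ℕ) (hj₂ : n₃ = 2 * ρ + 2 * j₂ + d % 2) (hr2 : Valued.v (r - 1) * Valued.v ϖ ^ (2 * t') = Valued.v ϖ ^ (2 * j₂)) :
    ((((Nat.card 𝓀[K] - 1) * Nat.card 𝓀[K] ^ (ρ + 2 * t' - 1)) * ((Nat.card 𝓀[K] - 1) * Nat.card 𝓀[K] ^ (2 * ρ - 1)) : ℕ) : ℚ) *
        ∑ g ∈ R, (labelledOddCount σ ϖ 0 2 (valueClassLabel σ ϖ (α - 1) (β - 1) (d % 2 + 2 * d - 1) d) (latt (V₀ g : Matrix (Fin 3) (Fin 3) K)) : ℚ) /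
            ((((unitStabilizer (latt (V₀ g : Matrix (Fin 3) (Fin 3) K))).map (unitNormMap σ 3)).relIndex (fixedUnitTorus σ 3) : ℕ) : ℚ) =
      (normSign σ eB : ℚ) / 2 * (Nat.card 𝓀[K] : ℚ) ^ (2 * ρ + t' - 1) *
        ((normSign σ (-1 : K) : ℚ) * ((if 2 * d + d % 2 + 2 * ρ ≤ n₃ then (Nat.card 𝓀[K] : ℚ) - 1 else 0) - (if n₃ + 2 = 2 * d + d % 2 + 2 * ρ then 1 else 0))) := by
  classical
  obtain ⟨hσ, hvσ, hϖ, hfix, hdd, hd1, ht₂⟩ := id hD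
  have hd2 : 2 ≤ d := two_le_d_of_v_two_lt_one hD h2
  obtain ⟨hϖ0, hϖ1⟩ := ne_zero_and_v_lt_one_of_v_eq_exp hϖ
  have hvϖ : 0 < Valued.v ϖ := (Valuation.pos_iff _).2 hϖ0
  have hσϖ0 : σ ϖ ≠ 0 := (map_ne_zero σ).2 hϖ0
  have hpw : ∀ a b : ℕ, Valued.v ϖ ^ a ≤ Valued.v ϖ ^ b ↔ b ≤ a := fun a b => by
    rw [v_varpi_pow hϖ, v_varpi_pow hϖ, WithZero.exp_le_exp]; omega
  have hpwi : ∀ a b : ℕ, Valued.v ϖ ^ a = Valued.v ϖ ^ b ↔ a = b := fun a b => by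
    rw [v_varpi_pow hϖ, v_varpi_pow hϖ, WithZero.exp_inj]; omega
  obtain ⟨-, -, -, -, -, -, -, -, hN1, hN2, hN3⟩ := id hE
  have hmcN : mcOfRecord d ≤ n0DerivedOfRecord d := mcOfRecord_le_n0DerivedOfRecord d
  have hmcv : mcOfRecord d = 2 * ((d % 2 + 2 * d - 1 + d) / 2) := rfl
  have hj₁1 : 1 ≤ j₁ := by omega
  have hj₁d : j₁ + 1 ≤ d := by omega
  have hq1 : 1 < Nat.card 𝓀[K] := Finite.one_lt_card
  have h11 : Valued.v (1 : K) = 1 := map_one _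
  have hπ0 : ((ϖ * σ ϖ) ^ (ρ + t') : K) ≠ 0 := pow_ne_zero _ (mul_ne_zero hϖ0 hσϖ0)
  have hσπ : σ ((ϖ * σ ϖ) ^ (ρ + t')) = (ϖ * σ ϖ) ^ (ρ + t') := by rw [map_pow, map_mul, hσ, mul_comm]
  have heB0 : eB ≠ 0 := fun h => by rw [h, map_zero] at heB1; exact zero_ne_one heB1
  have hσgβ : σ (eB * (ϖ * σ ϖ) ^ (ρ + t')) = eB * (ϖ * σ ϖ) ^ (ρ + t') := by rw [map_mul, hσeB, hσπ]
  have hgβ0 : eB * (ϖ * σ ϖ) ^ (ρ + t') ≠ 0 := mul_ne_zero heB0 hπ0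
  have hrglt : ∀ g ∈ R, Valued.v (r * g) < 1 := fun g hg => by rw [hvrg g hg]; exact pow_lt_one₀ zero_le hϖ1 (by omega)
  have h1rg0 : ∀ g ∈ R, (1 : K) + r * g ≠ 0 := fun g hg h => by
    have h' := Valued.v.map_one_add_of_lt (hrglt g hg); rw [h, map_zero] at h'; exact zero_ne_one h'
  have hσ1rg : ∀ g ∈ R, σ (1 + r * g) = 1 + r * g := fun g hg => by rw [map_add, map_one, map_mul, hσr, (hR1' g hg).1]
  have hc : ∀ g ∈ R, σ (r * g / (1 + r * g)) = r * g / (1 + r * g) := fun g hg => by rw [map_div₀, hσ1rg g hg, map_mul, hσr, (hR1' g hg).1]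
  have hck : ∀ g ∈ R, Valued.v (r * g / (1 + r * g)) = Valued.v ϖ ^ (2 * j₁) := fun g hg => by
    rw [map_div₀, Valued.v.map_one_add_of_lt (hrglt g hg), div_one, hvrg g hg]
  -- the per-orbit value (★ Orbits §5), `ε(g) = ω(e_B)ω(1+rg)`, the weight, the mass
  have hval := fun g (hg : g ∈ R) => value_latt_glued_rep_eq h2 hD hE T hT ρ t' hρ ht' hread hcap (hR1' g hg).1 (hR1' g hg).2 (V₀ g) (hV₀ g)
    hσr hσgβ hgβ0 (hprecα g hg) hprecβ j₁ hj₁ (hvrg g hg)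
  have hεg : ∀ g ∈ R, (normSign σ (eB * (ϖ * σ ϖ) ^ (ρ + t') * (1 + r * g)) : ℚ) = normSign σ eB * normSign σ (1 + r * g) := fun g hg =>
    normSign_unit_mul_normPow_mul hD hσeB heB1 (hσ1rg g hg) (h1rg0 g hg) (ρ + t')
  have hw : ∀ g ∈ R, stabiliserWeight σ (latt (V₀ g : Matrix (Fin 3) (Fin 3) K)) =
      ((((Nat.card 𝓀[K] - 1) * Nat.card 𝓀[K] ^ ((ρ + 2 * t' + 1) / 2 - 1)) * ((Nat.card 𝓀[K] - 1) * Nat.card 𝓀[K] ^ (ρ - 1)) : ℕ) : ℚ)⁻¹ := fun g hg =>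
    stabiliserWeight_latt_glued_tube_eq hσ hvσ hfix hϖ hdd hρ t' h11 h11 (hR1' g hg).2 (V₀ g) (hV₀ g) (hR1' g hg).1
      (by rw [map_one, (hR1' g hg).1, one_mul, sub_self, map_zero]; exact zero_le)
  have hmass := orbit_mass_eq_pow hq1 hρ t'
  have hj : (ρ + 2 * t' + 1) / 2 = (ρ + 1) / 2 + t' := by
    rw [show ρ + 2 * t' + 1 = ρ + 1 + t' * 2 by ring, Nat.add_mul_div_right _ _ (by norm_num : 0 < 2)]
  have e1 : 2 * ρ + 2 * t' - (ρ + 2 * t' + 1) / 2 + ((ρ + 1) / 2 - 1) = 2 * ρ + t' - 1 := by rw [hj]; omega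
  have epow : (Nat.card 𝓀[K] : ℚ) ^ (2 * ρ + t' - 1) =
      (Nat.card 𝓀[K] : ℚ) ^ (2 * ρ + 2 * t' - (ρ + 2 * t' + 1) / 2) * (Nat.card 𝓀[K] : ℚ) ^ ((ρ + 1) / 2 - 1) := by rw [← pow_add, e1]
  have hRcardQ : (R.card : ℚ) = ((Nat.card 𝓀[K] : ℚ) - 1) * (Nat.card 𝓀[K] : ℚ) ^ ((ρ + 1) / 2 - 1) := by
    rw [hRcard]; push_cast [Nat.cast_sub hq1.le]; ring
  set Wn : ℕ := ((Nat.card 𝓀[K] - 1) * Nat.card 𝓀[K] ^ ((ρ + 2 * t' + 1) / 2 - 1)) * ((Nat.card 𝓀[K] - 1) * Nat.card 𝓀[K] ^ (ρ - 1)) with hWn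
  set Nn : ℕ := ((Nat.card 𝓀[K] - 1) * Nat.card 𝓀[K] ^ (ρ + 2 * t' - 1)) * ((Nat.card 𝓀[K] - 1) * Nat.card 𝓀[K] ^ (2 * ρ - 1)) with hNn
  have key : ∀ x : ℚ, (Nn : ℚ) * (((Wn : ℕ) : ℚ)⁻¹ * x) = (Nat.card 𝓀[K] : ℚ) ^ (2 * ρ + 2 * t' - (ρ + 2 * t' + 1) / 2) * x := fun x => by
    rw [← mul_assoc, hmass]
  -- the Möbius form of `ω(1+rg)·ω(−1)ω(1+g)`
  have hmoe : ∀ g ∈ R, (normSign σ (1 + r * g) : ℚ) * (normSign σ (-1) * normSign σ (1 + g) : ℤ) =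
      normSign σ (-1) * normSign σ (1 + (r - 1) * (g / (1 + g))) := by
    intro g hg
    have hglt : Valued.v g < 1 := by rw [(hR1' g hg).2]; exact pow_lt_one₀ zero_le hϖ1 (by omega)
    have h1g0 : (1 : K) + g ≠ 0 := fun h => by
      have h' := Valued.v.map_one_add_of_lt hglt; rw [h, map_zero] at h'; exact zero_ne_one h'
    rw [← normSign_one_add_mul_one_add_eq σ (hR1' g hg).1 hglt,
      normSign_mul_of_fixed hD (by rw [map_add, map_one, (hR1' g hg).1]) (hσ1rg g hg) h1g0 (h1rg0 g hg)]
    push_cast; ring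
  have hκg : ∀ g ∈ R, Valued.v ((r - 1) / (1 + r * g)) = Valued.v (r - 1) := fun g hg => by
    rw [map_div₀, Valued.v.map_one_add_of_lt (hrglt g hg), div_one]
  have hj₂1 : 1 ≤ j₂ := by omega
  have hκ : ∀ g ∈ R, Valued.v ((r - 1) / (1 + r * g)) * Valued.v ϖ ^ (ρ + 2 * t') = Valued.v ϖ ^ (ρ + 2 * j₂) := fun g hg => by
    rw [hκg g hg, pow_add, mul_left_comm, hr2, ← pow_add]
  have hno₃ : ¬ (2 * d + d % 2 + 2 * ρ ≤ n₃) := by omega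
  rw [if_neg hno₃, zero_sub]
  by_cases hwin : 2 * d ≤ ρ + 2 * j₂ + 1
  · rw [Finset.sum_congr rfl (fun g hg => by
      rw [hval g hg 2, if_pos (forall_normSign_two_mul_gluedChar_of_le hD hρ ht' (hR1' g hg).1 (hR1' g hg).2 (V₀ g) (hV₀ g) hσr (Δ := 2 * j₁) (by omega)
        (le_of_eq (hvrg g hg)) (by omega) (by rw [hκ g hg, hpw]; omega)), hεg g hg, hw g hg])]
    simp only [Fin.isValue, Matrix.cons_val_two, Matrix.tail_cons, Matrix.head_cons]
    have hS' : ∑ g ∈ R, (normSign σ eB : ℚ) * normSign σ (1 + r * g) * ((normSign σ (-1) * normSign σ (1 + g) : ℤ) : ℚ) / 2 * ((1 : ℤ) : ℚ) * ((Wn : ℕ) : ℚ)⁻¹ =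
        (normSign σ eB : ℚ) * normSign σ (-1) / 2 * ((Wn : ℕ) : ℚ)⁻¹ * ((∑ g ∈ R, normSign σ (1 + (r - 1) * (g / (1 + g))) : ℤ) : ℚ) := by
      rw [Int.cast_sum, Finset.mul_sum]
      refine Finset.sum_congr rfl fun g hg => ?_
      rw [show (normSign σ eB : ℚ) * normSign σ (1 + r * g) * ((normSign σ (-1) * normSign σ (1 + g) : ℤ) : ℚ) =
          normSign σ eB * ((normSign σ (1 + r * g) : ℚ) * ((normSign σ (-1) * normSign σ (1 + g) : ℤ) : ℚ)) by ring, hmoe g hg]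
      push_cast; ring
    rw [hS', show (normSign σ eB : ℚ) * normSign σ (-1) / 2 * ((Wn : ℕ) : ℚ)⁻¹ * ((∑ g ∈ R, normSign σ (1 + (r - 1) * (g / (1 + g))) : ℤ) : ℚ) =
        ((Wn : ℕ) : ℚ)⁻¹ * ((normSign σ eB : ℚ) * normSign σ (-1) / 2 * ((∑ g ∈ R, normSign σ (1 + (r - 1) * (g / (1 + g))) : ℤ) : ℚ)) by ring, key]
    by_cases hbd : j₂ + 1 = d
    · have hS := sum_normSign_one_add_mul_moebius_boundary hD h2 hd2 hρ ht' R hR1' hR2' hR3' (κ := r - 1) (by rw [map_sub, map_one, hσr])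
        (by rw [hr2, hpwi]; omega)
      rw [hS, if_pos (show n₃ + 2 = 2 * d + d % 2 + 2 * ρ by omega), epow]
      push_cast
      ring
    · have hS := sum_normSign_one_add_mul_moebius_eq_zero hD h2 (t' := j₂) ht' hj₂1 (by omega) hwin R hR1' hR2' hR3' (κ := r - 1)
        (by rw [map_sub, map_one, hσr]) hr2
      rw [hS, if_neg (show ¬ (n₃ + 2 = 2 * d + d % 2 + 2 * ρ) by omega)]
      simp
  · rw [Finset.sum_congr rfl (fun g hg => by
      rw [hval g hg 2, if_neg (by
        obtain ⟨u, hu, hne⟩ := exists_normSign_two_mul_gluedChar_ne_one hD h2 hρ ht' (hR1' g hg).1 (hR1' g hg).2 (V₀ g) (hV₀ g) hσr (Δ := 2 * j₁) (by omega)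
          (le_of_eq (hvrg g hg)) (by omega) (by rw [hκ g hg, hpw]; omega)
        exact fun h => hne (h u hu))]),
      if_neg (show ¬ (n₃ + 2 = 2 * d + d % 2 + 2 * ρ) by omega)]
    simp

/-- **SLOT 2, CASE B** (`n₃ ≥ m* + 2ρ`, deep: `|r−1|·|ϖ|^{2t′} ≤ |ϖ|^{2d−1}`): the indicator is `1` on every orbit (★ p861641) and every `ω(1 + (r−1)g∕(1+g))` is `1`
(★ p861608 `sum_normSign_one_add_mul_moebius_eq_card`); total `ω(e_B)ω(−1)∕2 · q^{2ρ+t′−1} · (q − 1)`. [cite: Rogawski1990, §4.9 Prop. 4.9.1 (b) p. 55] [cite: Serre1979, Ch. XV §2] -/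
theorem card_mul_sum_value_two_eq_of_le (h2 : Valued.v (2 : K) < 1) (hD : IsRamifiedQuadraticDatum σ ϖ d t)
    (hE : IsElementDatum σ ϖ (n0DerivedOfRecord d) α β n₁ n₂ n₃)
    (T : GL (Fin 3) K) (hT : (T : Matrix (Fin 3) (Fin 3) K) = Matrix.diagonal ![α, β, 1]) (ρ t' : ℕ) (hρ : 1 ≤ ρ) (ht' : 1 ≤ t')
    (hbey : n₂ < 2 * ρ + (d % 2 + 2 * d - 1)) (hread : 2 * ρ + 2 * t' + d % 2 = n₁) (hcap : 2 * ρ + 2 + d % 2 ≤ min n₂ n₃)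
    {eB : K} (hσeB : σ eB = eB) (heB1 : Valued.v eB = 1)
    (R : Finset K) (hR1' : ∀ g ∈ R, σ g = g ∧ Valued.v g = Valued.v ϖ ^ (2 * t'))
    (hRcard : R.card = (Nat.card 𝓀[K] - 1) * Nat.card 𝓀[K] ^ ((ρ + 1) / 2 - 1))
    (V₀ : K → GL (Fin 3) K) (hV₀ : ∀ g, (V₀ g : Matrix (Fin 3) (Fin 3) K) = !![1, 0, 0; 1, ϖ ^ ρ, 0; 1 * 1 + g, ϖ ^ ρ * 1, ϖ ^ (2 * ρ + 2 * t')])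
    {r : K} (hσr : σ r = r) (j₁ : ℕ) (hj₁ : n₂ = 2 * ρ + 2 * j₁ + d % 2)
    (hprecα : ∀ g ∈ R, Valued.v ((ϖ ^ (d % 2 + 2 * d - 1))⁻¹ * (((ϖ * σ ϖ) ^ (ρ + t'))⁻¹ * g *
      ((α - 1) - r * (eB * (ϖ * σ ϖ) ^ (ρ + t')) * ((ϖ - σ ϖ) * ((ϖ * σ ϖ) ^ ((d - d % 2) / 2))⁻¹)))) ≤ 1)
    (hprecβ : Valued.v ((ϖ ^ (d % 2 + 2 * d - 1))⁻¹ * (((ϖ * σ ϖ) ^ (ρ + t'))⁻¹ *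
      ((β - 1) - (eB * (ϖ * σ ϖ) ^ (ρ + t')) * ((ϖ - σ ϖ) * ((ϖ * σ ϖ) ^ ((d - d % 2) / 2))⁻¹)))) ≤ 1)
    (hvrg : ∀ g ∈ R, Valued.v (r * g) = Valued.v ϖ ^ (2 * j₁))
    (hB : d % 2 + 2 * d - 1 + 2 * ρ ≤ n₃) (hp3 : n₃ % 2 = d % 2) (hrB : Valued.v (r - 1) * Valued.v ϖ ^ (2 * t') ≤ Valued.v ϖ ^ (2 * d - 1)) :
    ((((Nat.card 𝓀[K] - 1) * Nat.card 𝓀[K] ^ (ρ + 2 * t' - 1)) * ((Nat.card 𝓀[K] - 1) * Nat.card 𝓀[K] ^ (2 * ρ - 1)) : ℕ) : ℚ) *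
        ∑ g ∈ R, (labelledOddCount σ ϖ 0 2 (valueClassLabel σ ϖ (α - 1) (β - 1) (d % 2 + 2 * d - 1) d) (latt (V₀ g : Matrix (Fin 3) (Fin 3) K)) : ℚ) /
            ((((unitStabilizer (latt (V₀ g : Matrix (Fin 3) (Fin 3) K))).map (unitNormMap σ 3)).relIndex (fixedUnitTorus σ 3) : ℕ) : ℚ) =
      (normSign σ eB : ℚ) / 2 * (Nat.card 𝓀[K] : ℚ) ^ (2 * ρ + t' - 1) *
        ((normSign σ (-1 : K) : ℚ) * ((if 2 * d + d % 2 + 2 * ρ ≤ n₃ then (Nat.card 𝓀[K] : ℚ) - 1 else 0) - (if n₃ + 2 = 2 * d + d % 2 + 2 * ρ then 1 else 0))) := by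
  classical
  obtain ⟨hσ, hvσ, hϖ, hfix, hdd, hd1, ht₂⟩ := id hD
  have hd2 : 2 ≤ d := two_le_d_of_v_two_lt_one hD h2
  obtain ⟨hϖ0, hϖ1⟩ := ne_zero_and_v_lt_one_of_v_eq_exp hϖ
  have hvϖ : 0 < Valued.v ϖ := (Valuation.pos_iff _).2 hϖ0
  have hσϖ0 : σ ϖ ≠ 0 := (map_ne_zero σ).2 hϖ0
  have hpw : ∀ a b : ℕ, Valued.v ϖ ^ a ≤ Valued.v ϖ ^ b ↔ b ≤ a := fun a b => by
    rw [v_varpi_pow hϖ, v_varpi_pow hϖ, WithZero.exp_le_exp]; omega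
  have hpwi : ∀ a b : ℕ, Valued.v ϖ ^ a = Valued.v ϖ ^ b ↔ a = b := fun a b => by
    rw [v_varpi_pow hϖ, v_varpi_pow hϖ, WithZero.exp_inj]; omega
  obtain ⟨-, -, -, -, -, -, -, -, hN1, hN2, hN3⟩ := id hE
  have hmcN : mcOfRecord d ≤ n0DerivedOfRecord d := mcOfRecord_le_n0DerivedOfRecord d
  have hmcv : mcOfRecord d = 2 * ((d % 2 + 2 * d - 1 + d) / 2) := rfl
  have hj₁1 : 1 ≤ j₁ := by omega
  have hj₁d : j₁ + 1 ≤ d := by omega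
  have hq1 : 1 < Nat.card 𝓀[K] := Finite.one_lt_card
  have h11 : Valued.v (1 : K) = 1 := map_one _
  have hπ0 : ((ϖ * σ ϖ) ^ (ρ + t') : K) ≠ 0 := pow_ne_zero _ (mul_ne_zero hϖ0 hσϖ0)
  have hσπ : σ ((ϖ * σ ϖ) ^ (ρ + t')) = (ϖ * σ ϖ) ^ (ρ + t') := by rw [map_pow, map_mul, hσ, mul_comm]
  have heB0 : eB ≠ 0 := fun h => by rw [h, map_zero] at heB1; exact zero_ne_one heB1
  have hσgβ : σ (eB * (ϖ * σ ϖ) ^ (ρ + t')) = eB * (ϖ * σ ϖ) ^ (ρ + t') := by rw [map_mul, hσeB, hσπ]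
  have hgβ0 : eB * (ϖ * σ ϖ) ^ (ρ + t') ≠ 0 := mul_ne_zero heB0 hπ0
  have hrglt : ∀ g ∈ R, Valued.v (r * g) < 1 := fun g hg => by rw [hvrg g hg]; exact pow_lt_one₀ zero_le hϖ1 (by omega)
  have h1rg0 : ∀ g ∈ R, (1 : K) + r * g ≠ 0 := fun g hg h => by
    have h' := Valued.v.map_one_add_of_lt (hrglt g hg); rw [h, map_zero] at h'; exact zero_ne_one h'
  have hσ1rg : ∀ g ∈ R, σ (1 + r * g) = 1 + r * g := fun g hg => by rw [map_add, map_one, map_mul, hσr, (hR1' g hg).1]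
  have hc : ∀ g ∈ R, σ (r * g / (1 + r * g)) = r * g / (1 + r * g) := fun g hg => by rw [map_div₀, hσ1rg g hg, map_mul, hσr, (hR1' g hg).1]
  have hck : ∀ g ∈ R, Valued.v (r * g / (1 + r * g)) = Valued.v ϖ ^ (2 * j₁) := fun g hg => by
    rw [map_div₀, Valued.v.map_one_add_of_lt (hrglt g hg), div_one, hvrg g hg]
  -- the per-orbit value (★ Orbits §5), `ε(g) = ω(e_B)ω(1+rg)`, the weight, the mass
  have hval := fun g (hg : g ∈ R) => value_latt_glued_rep_eq h2 hD hE T hT ρ t' hρ ht' hread hcap (hR1' g hg).1 (hR1' g hg).2 (V₀ g) (hV₀ g)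
    hσr hσgβ hgβ0 (hprecα g hg) hprecβ j₁ hj₁ (hvrg g hg)
  have hεg : ∀ g ∈ R, (normSign σ (eB * (ϖ * σ ϖ) ^ (ρ + t') * (1 + r * g)) : ℚ) = normSign σ eB * normSign σ (1 + r * g) := fun g hg =>
    normSign_unit_mul_normPow_mul hD hσeB heB1 (hσ1rg g hg) (h1rg0 g hg) (ρ + t')
  have hw : ∀ g ∈ R, stabiliserWeight σ (latt (V₀ g : Matrix (Fin 3) (Fin 3) K)) =
      ((((Nat.card 𝓀[K] - 1) * Nat.card 𝓀[K] ^ ((ρ + 2 * t' + 1) / 2 - 1)) * ((Nat.card 𝓀[K] - 1) * Nat.card 𝓀[K] ^ (ρ - 1)) : ℕ) : ℚ)⁻¹ := fun g hg =>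
    stabiliserWeight_latt_glued_tube_eq hσ hvσ hfix hϖ hdd hρ t' h11 h11 (hR1' g hg).2 (V₀ g) (hV₀ g) (hR1' g hg).1
      (by rw [map_one, (hR1' g hg).1, one_mul, sub_self, map_zero]; exact zero_le)
  have hmass := orbit_mass_eq_pow hq1 hρ t'
  have hj : (ρ + 2 * t' + 1) / 2 = (ρ + 1) / 2 + t' := by
    rw [show ρ + 2 * t' + 1 = ρ + 1 + t' * 2 by ring, Nat.add_mul_div_right _ _ (by norm_num : 0 < 2)]
  have e1 : 2 * ρ + 2 * t' - (ρ + 2 * t' + 1) / 2 + ((ρ + 1) / 2 - 1) = 2 * ρ + t' - 1 := by rw [hj]; omega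
  have epow : (Nat.card 𝓀[K] : ℚ) ^ (2 * ρ + t' - 1) =
      (Nat.card 𝓀[K] : ℚ) ^ (2 * ρ + 2 * t' - (ρ + 2 * t' + 1) / 2) * (Nat.card 𝓀[K] : ℚ) ^ ((ρ + 1) / 2 - 1) := by rw [← pow_add, e1]
  have hRcardQ : (R.card : ℚ) = ((Nat.card 𝓀[K] : ℚ) - 1) * (Nat.card 𝓀[K] : ℚ) ^ ((ρ + 1) / 2 - 1) := by
    rw [hRcard]; push_cast [Nat.cast_sub hq1.le]; ring
  set Wn : ℕ := ((Nat.card 𝓀[K] - 1) * Nat.card 𝓀[K] ^ ((ρ + 2 * t' + 1) / 2 - 1)) * ((Nat.card 𝓀[K] - 1) * Nat.card 𝓀[K] ^ (ρ - 1)) with hWn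
  set Nn : ℕ := ((Nat.card 𝓀[K] - 1) * Nat.card 𝓀[K] ^ (ρ + 2 * t' - 1)) * ((Nat.card 𝓀[K] - 1) * Nat.card 𝓀[K] ^ (2 * ρ - 1)) with hNn
  have key : ∀ x : ℚ, (Nn : ℚ) * (((Wn : ℕ) : ℚ)⁻¹ * x) = (Nat.card 𝓀[K] : ℚ) ^ (2 * ρ + 2 * t' - (ρ + 2 * t' + 1) / 2) * x := fun x => by
    rw [← mul_assoc, hmass]
  have hmoe : ∀ g ∈ R, (normSign σ (1 + r * g) : ℚ) * (normSign σ (-1) * normSign σ (1 + g) : ℤ) =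
      normSign σ (-1) * normSign σ (1 + (r - 1) * (g / (1 + g))) := by
    intro g hg
    have hglt : Valued.v g < 1 := by rw [(hR1' g hg).2]; exact pow_lt_one₀ zero_le hϖ1 (by omega)
    have h1g0 : (1 : K) + g ≠ 0 := fun h => by
      have h' := Valued.v.map_one_add_of_lt hglt; rw [h, map_zero] at h'; exact zero_ne_one h'
    rw [← normSign_one_add_mul_one_add_eq σ (hR1' g hg).1 hglt,
      normSign_mul_of_fixed hD (by rw [map_add, map_one, (hR1' g hg).1]) (hσ1rg g hg) h1g0 (h1rg0 g hg)]
    push_cast; ring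
  have hκg : ∀ g ∈ R, Valued.v ((r - 1) / (1 + r * g)) = Valued.v (r - 1) := fun g hg => by
    rw [map_div₀, Valued.v.map_one_add_of_lt (hrglt g hg), div_one]
  have hyes₃ : 2 * d + d % 2 + 2 * ρ ≤ n₃ := by omega
  rw [if_pos hyes₃, if_neg (show ¬ (n₃ + 2 = 2 * d + d % 2 + 2 * ρ) by omega), sub_zero]
  rw [Finset.sum_congr rfl (fun g hg => by
    rw [hval g hg 2, if_pos (forall_normSign_two_mul_gluedChar_of_le hD hρ ht' (hR1' g hg).1 (hR1' g hg).2 (V₀ g) (hV₀ g) hσr (Δ := 2 * j₁) (by omega)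
      (le_of_eq (hvrg g hg)) (by omega) (by
        rw [hκg g hg, pow_add, mul_left_comm]
        calc Valued.v ϖ ^ ρ * (Valued.v (r - 1) * Valued.v ϖ ^ (2 * t')) ≤ 1 * Valued.v ϖ ^ (2 * d - 1) :=
              mul_le_mul' (pow_le_one₀ zero_le hϖ1.le) hrB
          _ = Valued.v ϖ ^ (2 * d - 1) := one_mul _)), hεg g hg, hw g hg])]
  simp only [Fin.isValue, Matrix.cons_val_two, Matrix.tail_cons, Matrix.head_cons]
  have hS' : ∑ g ∈ R, (normSign σ eB : ℚ) * normSign σ (1 + r * g) * ((normSign σ (-1) * normSign σ (1 + g) : ℤ) : ℚ) / 2 * ((1 : ℤ) : ℚ) * ((Wn : ℕ) : ℚ)⁻¹ =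
      (normSign σ eB : ℚ) * normSign σ (-1) / 2 * ((Wn : ℕ) : ℚ)⁻¹ * ((∑ g ∈ R, normSign σ (1 + (r - 1) * (g / (1 + g))) : ℤ) : ℚ) := by
    rw [Int.cast_sum, Finset.mul_sum]
    refine Finset.sum_congr rfl fun g hg => ?_
    rw [show (normSign σ eB : ℚ) * normSign σ (1 + r * g) * ((normSign σ (-1) * normSign σ (1 + g) : ℤ) : ℚ) =
        normSign σ eB * ((normSign σ (1 + r * g) : ℚ) * ((normSign σ (-1) * normSign σ (1 + g) : ℤ) : ℚ)) by ring, hmoe g hg]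
    push_cast; ring
  rw [hS', show (normSign σ eB : ℚ) * normSign σ (-1) / 2 * ((Wn : ℕ) : ℚ)⁻¹ * ((∑ g ∈ R, normSign σ (1 + (r - 1) * (g / (1 + g))) : ℤ) : ℚ) =
      ((Wn : ℕ) : ℚ)⁻¹ * ((normSign σ eB : ℚ) * normSign σ (-1) / 2 * ((∑ g ∈ R, normSign σ (1 + (r - 1) * (g / (1 + g))) : ℤ) : ℚ)) by ring, key,
    sum_normSign_one_add_mul_moebius_eq_card hD ht' R hR1' (κ := r - 1) (by rw [map_sub, map_one, hσr]) hrB]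
  push_cast
  rw [hRcardQ, epow]
  ring

/-! ## §2  THE HEAD — the `hP3G1` letter -/

/-- **β-BOARD R3 — THE `G₁ = (2ρ, 2ρ+s, 2ρ+s)` CAPPED TUBE CLASSES BEYOND THE ONE-SLOT CELL** (`n₂ < 2ρ + m*`, read `2ρ + s + ℓ₀ = n₁`, `2 ∣ s`, cap `2ρ + 2 + ℓ₀ ≤ min n₂ n₃`):
`Σᶠ_{M ∈ stratum G₁, shell} labelledOddCount σ ϖ 0 i Λ M ∕ [𝒰 : N(S̃′(M))] = ω(e_B)∕2 · q^{2ρ+s∕2−1} · (0, F(n₂), ω(−1)·F(n₃))_i`,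
`F(n) = (q−1)·[2d + ℓ₀ + 2ρ ≤ n] − [n + 2 = 2d + ℓ₀ + 2ρ]` (the PER-SLOT twist depth `n − ℓ₀ − 2ρ`) — the `hP3G1` letter of (T2) `hbox_of_oddBoxSum` ∕ (T1) ★ p861261 `hG1b` VERBATIM
(★ Orbits §3 decomposition, §4 ratio; ★ Slots; §1). [cite: Kottwitz1986BaseChangeUnits, §1 pp. 240–241] [cite: Rogawski1990, §4.9 Prop. 4.9.1 (a)(b) p. 55, §4.10 p. 58] [cite: LanglandsShelstad1987, §3]
[cite: Serre1979, Ch. V §3, Ch. XV §2] -/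
theorem finsum_stratum_G1_beyond_shell_labelledOdd_div_relIndex_eq (h2 : Valued.v (2 : K) < 1) (hD : IsRamifiedQuadraticDatum σ ϖ d t)
    (hE : IsElementDatum σ ϖ (n0DerivedOfRecord d) α β n₁ n₂ n₃)
    (T : GL (Fin 3) K) (hT : (T : Matrix (Fin 3) (Fin 3) K) = Matrix.diagonal ![α, β, 1]) (ρ s : ℕ) (hρ : 1 ≤ ρ)
    (hbey : n₂ < 2 * ρ + mstarOfRecord d) (hread : 2 * ρ + s + d % 2 = n₁) (hpar : 2 ∣ s) (hcap : 2 * ρ + 2 + d % 2 ≤ min n₂ n₃)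
    {eB : K} (hσeB : σ eB = eB) (heB1 : Valued.v eB = 1)
    (heB : Valued.v ((ϖ ^ mstarOfRecord d)⁻¹ * ((β - 1) * ((ϖ * σ ϖ) ^ ((n₁ - d % 2) / 2))⁻¹ - eB * ((ϖ - σ ϖ) * ((ϖ * σ ϖ) ^ ((d - d % 2) / 2))⁻¹))) ≤ 1)
    (i : Fin 3) :
    ∑ᶠ M ∈ {M : Submodule 𝒪[K] (Fin 3 → K) | M ∈ stratum σ ϖ T ![2 * ρ, 2 * ρ + s, 2 * ρ + s] ∧
        (LatticeInLevel ϖ (d % 2) (Matrix.diagonal ![α - 1, β - 1, 0]) M ∧ ¬ LatticeInLevel ϖ (d % 2 + 1) (Matrix.diagonal ![α - 1, β - 1, 0]) M ∧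
          LatticeInLevel ϖ (mcOfRecord d) (Matrix.diagonal ![(α - 1) * (α - 1), (β - 1) * (β - 1), 0]) M)},
      (labelledOddCount σ ϖ 0 i (valueClassLabel σ ϖ (α - 1) (β - 1) (mstarOfRecord d) d) M : ℚ) /
        ((((unitStabilizer M).map (unitNormMap σ 3)).relIndex (fixedUnitTorus σ 3) : ℕ) : ℚ) =
      (normSign σ eB : ℚ) / 2 * (Fintype.card 𝓀[K] : ℚ) ^ (2 * ρ + s / 2 - 1) *
        (![(0 : ℚ), ((if 2 * d + d % 2 + 2 * ρ ≤ n₂ then (Fintype.card 𝓀[K] : ℚ) - 1 else 0) - (if n₂ + 2 = 2 * d + d % 2 + 2 * ρ then 1 else 0)),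
            (normSign σ (-1 : K) : ℚ) * ((if 2 * d + d % 2 + 2 * ρ ≤ n₃ then (Fintype.card 𝓀[K] : ℚ) - 1 else 0) - (if n₃ + 2 = 2 * d + d % 2 + 2 * ρ then 1 else 0))] : Fin 3 → ℚ) i := by
  classical
  obtain ⟨hσ, hvσ, hϖ, hfix, hdd, hd1, ht₂⟩ := id hD
  have hd2 : 2 ≤ d := two_le_d_of_v_two_lt_one hD h2
  obtain ⟨hϖ0, hϖ1⟩ := ne_zero_and_v_lt_one_of_v_eq_exp hϖ
  have hpwi : ∀ a b : ℕ, Valued.v ϖ ^ a = Valued.v ϖ ^ b ↔ a = b := fun a b => by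
    rw [v_varpi_pow hϖ, v_varpi_pow hϖ, WithZero.exp_inj]; omega
  obtain ⟨hαn, hβn, -, -, -, h₁, h₂, h₃, hN1, hN2, hN3⟩ := id hE
  have hmcN : mcOfRecord d ≤ n0DerivedOfRecord d := mcOfRecord_le_n0DerivedOfRecord d
  have hmcv : mcOfRecord d = 2 * ((d % 2 + 2 * d - 1 + d) / 2) := rfl
  have hmsv : mstarOfRecord d = d % 2 + 2 * d - 1 := rfl
  rw [hmsv] at hbey heB ⊢
  have hdN : d ≤ n0DerivedOfRecord d := by omega
  obtain ⟨hp1, hp2, hp3⟩ := depth_mod_two_eq_of_isElementDatum hD hE hdN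
  obtain ⟨hi1, hi2, hi3⟩ := isoceles_depths hϖ h₁ h₂ h₃
  obtain ⟨t', rfl⟩ := hpar
  have ht' : 1 ≤ t' := by
    by_contra h0
    have h00 : t' = 0 := by omega
    subst h00
    omega
  rw [show 2 * t' / 2 = t' by omega, ← Nat.card_eq_fintype_card]
  have hjn : (n₁ - d % 2) / 2 = ρ + t' := by omega
  rw [hjn] at heB
  obtain ⟨j₁, hj₁⟩ : ∃ j₁ : ℕ, n₂ = 2 * ρ + 2 * j₁ + d % 2 := ⟨(n₂ - 2 * ρ - d % 2) / 2, by omega⟩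
  -- the class representatives and the reference frames
  obtain ⟨R₀, hR₀fin, hR₀card, hR1, hR2, hR3⟩ := exists_fixed_class_representatives hσ hvσ hfix hϖ hdd ρ t' hρ
  set R : Finset K := hR₀fin.toFinset with hRdef
  have hmemR : ∀ g, g ∈ R ↔ g ∈ R₀ := fun g => Set.Finite.mem_toFinset hR₀fin
  have hRcard : R.card = (Nat.card 𝓀[K] - 1) * Nat.card 𝓀[K] ^ ((ρ + 1) / 2 - 1) := by rw [hRdef, ← Set.ncard_eq_toFinset_card R₀ hR₀fin]; exact hR₀card
  have hR1' : ∀ g ∈ R, σ g = g ∧ Valued.v g = Valued.v ϖ ^ (2 * t') := fun g hg => hR1 g ((hmemR g).1 hg)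
  have hR2' : ∀ f : K, σ f = f → Valued.v f = Valued.v ϖ ^ (2 * t') → ∃ g ∈ R, Valued.v (f - g) ≤ Valued.v ϖ ^ (ρ + 2 * t') :=
    fun f hσf hvf => by obtain ⟨g, hg, h⟩ := hR2 f hσf hvf; exact ⟨g, (hmemR g).2 hg, h⟩
  have hR3' : ∀ g ∈ R, ∀ g' ∈ R, Valued.v (g - g') ≤ Valued.v ϖ ^ (ρ + 2 * t') → g = g' :=
    fun g hg g' hg' h => hR3 g ((hmemR g).1 hg) g' ((hmemR g').1 hg') h
  choose V₀ hV₀ using fun g : K => exists_gl_coe_eq_glued (1 : K) 1 g (pow_ne_zero ρ hϖ0) (pow_ne_zero (2 * ρ + 2 * t') hϖ0)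
  -- the ratio of the approximants
  obtain ⟨r, hσr, hprecβ, hgf, hvr, hr1A, hr1B⟩ := exists_ratio_beyond hD hE ρ t' ht' hbey hread hcap hσeB heB1 heB
  have hprecα := fun g (hg : g ∈ R) => (hgf g (hR1' g hg).2).1
  have hvrg : ∀ g ∈ R, Valued.v (r * g) = Valued.v ϖ ^ (2 * j₁) := fun g hg => by rw [(hgf g (hR1' g hg).2).2, hpwi]; omega
  have hvr2t : Valued.v r * Valued.v ϖ ^ (2 * t') = Valued.v ϖ ^ (2 * j₁) := by rw [hvr, hpwi]; omega
  -- decomposition, then the slots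
  rw [finsum_beyond_eq_card_mul_sum h2 hD hE T hT ρ t' hρ ht' hread hcap R hR1' hR2' hR3' V₀ hV₀ i]
  fin_cases i
  · simp only [Fin.zero_eta, Fin.isValue, Matrix.cons_val_zero, mul_zero]
    exact card_mul_sum_value_zero_eq h2 hD hE T hT ρ t' hρ ht' hbey hread hcap hσeB heB1 R hR1' hR2' hR3' hRcard V₀ hV₀ hσr j₁ hj₁ hprecα hprecβ hvrg hvr2t
  · simp only [Fin.mk_one, Fin.isValue, Matrix.cons_val_one, Matrix.cons_val_zero]
    exact card_mul_sum_value_one_eq h2 hD hE T hT ρ t' hρ ht' hbey hread hcap hσeB heB1 R hR1' hR2' hR3' hRcard V₀ hV₀ hσr j₁ hj₁ hprecα hprecβ hvrg hvr2t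
  · simp only [Fin.reduceFinMk, Fin.isValue, Matrix.cons_val_two, Matrix.tail_cons, Matrix.head_cons]
    by_cases hA : n₃ < d % 2 + 2 * d - 1 + 2 * ρ
    · obtain ⟨j₂, hj₂⟩ : ∃ j₂ : ℕ, n₃ = 2 * ρ + 2 * j₂ + d % 2 := ⟨(n₃ - 2 * ρ - d % 2) / 2, by omega⟩
      exact card_mul_sum_value_two_eq_of_lt h2 hD hE T hT ρ t' hρ ht' hbey hread hcap hσeB heB1 R hR1' hR2' hR3' hRcard V₀ hV₀ hσr j₁ hj₁ hprecα hprecβ hvrg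
        hA j₂ hj₂ (by rw [hr1A hA, hpwi]; omega)
    · push Not at hA
      exact card_mul_sum_value_two_eq_of_le h2 hD hE T hT ρ t' hρ ht' hbey hread hcap hσeB heB1 R hR1' hRcard V₀ hV₀ hσr j₁ hj₁ hprecα hprecβ hvrg
        hA hp3 (hr1B hA)


end Summit.HodgeConjecture.HodgeConjecture.Cruxes.H413.F0P3cDyRamLabelledOddBoundaryG1

end
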